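import Literature.AnabelianGeometry.EtaleTheta.Discharge.Sec2Cor28iIsStandardChiCusp
import Literature.AnabelianGeometry.EtaleTheta.Discharge.Sec2Def27OrbitsOfStandardTypeModelChi
import Literature.AnabelianGeometry.EtaleTheta.SettingModelTateDeckLevels
import Literature.AnabelianGeometry.EtaleTheta.SettingModelChiProp15iiiSplitNegative
import Literature.AnabelianGeometry.EtaleTheta.SettingModelChiCuspDef19Anchored
import HarnessLib

/-!
# [EtTh] Prop 1.5 (iii)'s deck display AT STAGE 1 for the model theta class; Def 1.9 (ii) (F-0573) and Thm 1.10 (i)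
# uniqueness (F-0513) for `η̈^Θ = etaDdχ` at the ANCHORED Def 1.9 datum of the cusped inversion model `χ′` (proof-only)

S. Mochizuki, *The étale theta function …* [EtTh], Publ. RIMS **45** (2009), §1: Prop 1.5 (iii) PRIMS PDF p.23 («`a ∈ Z` acts
via `η̈^Θ ↦ η̈^Θ − 2a·log(Ü) − (a²/2)·log(q_X) + log(O^×_K̈)`»), Def 1.9 (i)(ii) p.29, Thm 1.10 (i) p.29 («determines … up to
multiplication by `±1`»), Prop 1.4 (iii) p.22; §2 Def 2.7 p.41 (bib key `MochizukiEtTh2009`).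
PROOF-ONLY companion (0 `def`, 0 `instance`, no new `Prop`; cell abc-iut, layer L2, seat abc-iut-f-151 gen 7 — in-lineage sequel
«O1» of this seat's N-C28I-1 files p499029/p499352/p500300 = piece (b) of abc-iut-w6-d049's VNEXT note for THE class of record
at THE anchored datum; abc-iut-L2-lead R1177/R1195/R1228; every input BY NAME, nothing restated).
* §1 levels `(0, y, z − y)` of `a⁻¹γa` and `θ(inl((a⁻¹γa)·b^{−ŷ})) = θ(inl(γ·b^{−ŷ(γ)}))·c^{−ŷ(g)}` at STAGE 1 (abc-iut-L2-t6's
  stage-2 `toTheta_inl_zRepr_deckConj` without the Tate-shear terms: `actχ τ a = a`);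
* §2 **`conj_genA_etaDdχ`** — PROP 1.5 (iii)'s DISPLAY ON THE NOSE at the stage-1 χ-model: `σ₀·η̈^Θ = η̈^Θ·log(Ü)^{−2}` for
  `σ₀ = (a, 1)` and abc-iut-L2-d1's `etaDdχ` (no `log(q̈)`-term, unit `1` — cf. abc-iut-L2-t12's
  `SettingModelChiProp15iiiSplitNegative`); `conj_genA_zpow_etaDdχ` — `σ₀^k·η̈^Θ = η̈^Θ·log(Ü)^{−2k}`;
* §3 orbit and values at `MuTwoSetting.inversionModelχ′` (abc-iut-w5-d140; `ε_Z := epsZInvχ = a`): every member of `η̈^{Θ,Z}` is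
  `η̈^Θ·log(Ü)^{−2k}` (abc-iut-f-113's `Π^tp_Ẋ ∩ Π^tp_X = Π^tp_Ÿ·⟨a⟩` re-read at `Π^tp_X ⋊_ι ℤ/2`); `η̈^Θ|_D = 1` on every
  `b`-axis section (class form of Part I §1); at abc-iut-w5-d118's ANCHORED point `Ü = w` every value is `w^{−2k}`;
* §4 **`isOfStandardType_etaDdχ_anchoredStandardDataχ'Sec`** — Def 1.9 (ii) `MuTwoSetting.IsOfStandardType` (FACT-LIST
  F-0573 `OrbitsOfStandardType` is this predicate for every choice `X̲̲`, by `Iff.rfl`) HOLDS for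
  `etaDdχ` at abc-iut-L2-t10's ANCHORED datum `anchoredStandardDataχ′Sec` (`p ≡ 1 (mod 4)`; values at `τ` in `{±1}`, `1` attained)
  — hitherto F-0573 was carried at models only by abc-iut-f-113's TEST classes and abc-iut-f-132's RELABELLED section point;
  **`thm110iUnique_etaDdχ_anchoredStandardDataχ'Sec`** — FACT-LIST F-0513 `Thm110iUnique` for the class of record at the same
  datum (`(u·η̈)^{Θ,Z}` has values `±u` at `τ^{±1}`, so standard type pins `u = ±1`).
HONEST FRAMING: semi-synthetic model (the theta class OF THE MODEL; its values `±1` at the anchored `τ` are the model's, not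
print's `Θ̈(√−1)`) = consistency / non-vacuity evidence for the TYPED interface only; the ∀-closures of F-0573 / F-0513 are
refuted elsewhere (`not_forall_orbitsOfStandardType`, `not_forall_thm110iUnique`); [EtTh] is refereed and nothing of it is
asserted; no side is taken on [IUTchIII] Cor 3.12; typed ≠ proved; instantiated ≠ endorsed.
-/

noncomputable section

namespace Literature.AnabelianGeometry.EtaleTheta.SettingModel

open Literature.AnabelianGeometry.SemiGraphs _root_.Function
open scoped commutatorElement

variable (p : ℕ) [Fact p.Prime]

/-! ## §1. The `a`-conjugate at STAGE 1 (no Tate shear: `σ·a = a`) -/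

/-- **Levels of `a⁻¹ γ a`** for `γ ∈ Γ` of degree `0` (`ĥ_N(γ) = (0, y, z)`): `ĥ_N(a⁻¹ γ a) = (0, y, z − y)`.
[cite: MochizukiEtTh2009, Prop 1.5 (iii) p.23] -/
theorem hHat_gfpFst_conj_genA (N : ℕ+) {γ : Gfp} (hγ : gfpSnd γ = 1) :
    hHat N (gfpFst ((gfpOf (FreeGroup.of 0))⁻¹ * γ * gfpOf (FreeGroup.of 0))) =
      ⟨0, (hHat N (gfpFst γ)).y, (hHat N (gfpFst γ)).z - (hHat N (gfpFst γ)).y⟩ := by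
  have hx : (hHat N (gfpFst γ)).x = 0 := levelHom_x_eq_zero hγ
  simp only [map_mul, map_inv, hHat_gfpFst_gfpOf_a]
  ext
  · simp [hx]
  · simp
  · simp [hx]
    ring

/-- **`z`-part of the `a`-conjugate in the theta quotient, stage 1**: `θ(inl((a⁻¹γa)·b^{−ŷ})) = θ(inl(γ·b^{−ŷ(γ)}))·c^{−ŷ(g)}`
(abc-iut-L2-t6's stage-2 `toTheta_inl_zRepr_deckConj` without the Tate-shear terms). [cite: MochizukiEtTh2009, Prop 1.5 (iii) p.23] -/
theorem toTheta_inl_centreRep_conj_genA {g : PiTpχ p} (hg : gfpSnd g.left = 1) :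
    CurveTheta.toTheta (curveχ p) (SemidirectProduct.inl
        (centreRep ((gfpOf (FreeGroup.of 0))⁻¹ * g.left * gfpOf (FreeGroup.of 0)))) =
      CurveTheta.toTheta (curveχ p) (SemidirectProduct.inl (centreRep g.left)) * (cThetaχ p (yCoordχ p g))⁻¹ := by
  have hγ' : gfpSnd ((gfpOf (FreeGroup.of 0))⁻¹ * g.left * gfpOf (FreeGroup.of 0)) = 1 := by
    rw [map_mul, map_mul, map_inv, hg, mul_one, inv_mul_cancel]
  have key : CurveTheta.toTheta (curveχ p) (SemidirectProduct.inl
        (centreRep ((gfpOf (FreeGroup.of 0))⁻¹ * g.left * gfpOf (FreeGroup.of 0)))) =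
      CurveTheta.toTheta (curveχ p) (SemidirectProduct.inl (centreRep g.left * (cGfpχ (yCoordχ p g))⁻¹)) := by
    refine toTheta_eq_of_right_eq_one p _ _ (SemidirectProduct.right_inl _) (SemidirectProduct.right_inl _) ?_
    rw [SemidirectProduct.left_inl, SemidirectProduct.left_inl, mem_closure_commutator₃_iff_forall_hHat]
    intro N
    have hy : (hHat N (gfpFst g.left)).y = Multiplicative.toAdd (ZHatLevel.level N (eHatB (gfpFst g.left))) := by
      rw [← modN_eq_level, ← hHat_y_eq_modN_eHatB, toAdd_ofAdd]
    have h1 : hHat N (gfpFst (centreRep ((gfpOf (FreeGroup.of 0))⁻¹ * g.left * gfpOf (FreeGroup.of 0)))) =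
        ⟨0, 0, (hHat N (gfpFst g.left)).z - (hHat N (gfpFst g.left)).y⟩ := by
      unfold centreRep
      rw [hHat_gfpFst_mul_bPowGfp_inv N hγ', hHat_gfpFst_conj_genA N hg]
    have h2 : hHat N (gfpFst (centreRep g.left)) = ⟨0, 0, (hHat N (gfpFst g.left)).z⟩ := by
      unfold centreRep
      rw [hHat_gfpFst_mul_bPowGfp_inv N hg]
    simp only [map_mul, map_inv, h1, h2, hHat_gfpFst_cGfpχ, yCoordχ]
    ext
    · simp
    · simp
    · simp [hy]
      ring
  rw [cThetaχ_apply, key]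
  simp only [map_mul, map_inv]

/-- `σ₀⁻¹ (γ, τ) σ₀ = (a⁻¹ γ a, τ)` for `σ₀ = (a, 1)` at stage 1 (`τ·a = a`). [cite: MochizukiEtTh2009, Prop 1.5 (iii) p.23] -/
theorem genA_inv_mul_mul_genA (g : PiTpχ p) :
    (SemidirectProduct.inl (gfpOf (FreeGroup.of 0)) : PiTpχ p)⁻¹ * g * SemidirectProduct.inl (gfpOf (FreeGroup.of 0)) =
      ⟨(gfpOf (FreeGroup.of 0))⁻¹ * g.left * gfpOf (FreeGroup.of 0), g.right⟩ := by
  refine SemidirectProduct.ext ?_ ?_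
  · simp only [SemidirectProduct.mul_left, SemidirectProduct.inv_left, SemidirectProduct.left_inl,
      SemidirectProduct.right_inl, SemidirectProduct.mul_right, SemidirectProduct.inv_right, inv_one, map_one,
      MulAut.one_apply, one_mul, actχ_gfpOf_zero]
  · simp only [SemidirectProduct.mul_right, SemidirectProduct.inv_right, SemidirectProduct.right_inl, inv_one,
      one_mul, mul_one]

/-! ## §2. The STAGE-1 display `σ₀·η̈^Θ = η̈^Θ · log(Ü)^{−2}` (no `log(q̈)`-term, unit `1`) and its powers -/

/-- **Prop 1.5 (iii)'s display at the STAGE-1 χ-model, ON THE NOSE**: `σ₀·η̈^Θ = η̈^Θ · log(Ü)^{−2}` in `H¹(Π^tp_Ÿ, Δ_Θ)` for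
`σ₀ = (a, 1)` — cocycle-level `θ(σ₀⁻¹gσ₀) = θ(g)·c^{−ŷ(g)}` (§1), `log(Ü)(g)² = c^{ŷ(g)}`, and `σ₀` centralises `Δ_Θ` (`aug σ₀ = 1`);
no `log(q̈)`-term at stage 1 (abc-iut-L2-t12's `SettingModelChiProp15iiiSplitNegative`). [cite: MochizukiEtTh2009, Prop 1.5 (iii) p.23] -/
theorem conj_genA_etaDdχ (hC : (ThetaSetting.modelχ p).Compat) :
    haveI := hC.GtpYdd_normal
    ContH1.conj (ThetaSetting.modelχ p).toTheta (ThetaSetting.modelχ p).DeltaTheta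
        (SemidirectProduct.inl (gfpOf (FreeGroup.of 0)) : PiTpχ p) (etaDdχ p) =
      etaDdχ p *
        ((ThetaSetting.modelχ p).inflTheta (ThetaSetting.modelχ p).GtpYdd (logUddχ p)) ^ (-2 : ℤ) := by
  haveI := hC.GtpYdd_normal
  set g₀ := ContH1.resCocycle (ThetaSetting.modelχ p).toTheta (ThetaSetting.modelχ p).DeltaTheta
    (ThetaSetting.modelχ p).GtpYdd_le_GtpY (thetaCocycleχ p) with hg₀
  set L := ContH1.inflCocycle (ThetaSetting.modelχ p).DeltaTheta (ThetaSetting.modelχ p).toTheta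
    (ThetaSetting.modelχ p).continuous_toTheta
    (le_rfl : (ThetaSetting.modelχ p).GtpYdd.map (ThetaSetting.modelχ p).toTheta ≤ _)
    ⟨logUddFunχ p, logUddFunχ_mem p⟩ with hL
  have h1 : etaDdχ p = (QuotientGroup.mk g₀ : ContH1 _ _ _) := rfl
  have h2 : (ThetaSetting.modelχ p).inflTheta (ThetaSetting.modelχ p).GtpYdd (logUddχ p) =
      (QuotientGroup.mk L : ContH1 _ _ _) := rfl
  suffices hcoc : ContH1.conjCocycle (ThetaSetting.modelχ p).toTheta (ThetaSetting.modelχ p).DeltaTheta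
      (SemidirectProduct.inl (gfpOf (FreeGroup.of 0)) : PiTpχ p) g₀ = g₀ * L ^ (-2 : ℤ) by
    rw [h1, h2, ContH1.conj_mk, hcoc]
    rfl
  apply Subtype.ext
  funext x
  have hxY : ((x : PiTpχ p)) ∈ (ThetaSetting.modelχ p).GtpY := (ThetaSetting.modelχ p).GtpYdd_le_GtpY x.2
  have hconj : (((MulAut.conjNormal (SemidirectProduct.inl (gfpOf (FreeGroup.of 0)) : PiTpχ p)⁻¹) x :
      ↥(ThetaSetting.modelχ p).GtpYdd) : PiTpχ p) =
      ⟨(gfpOf (FreeGroup.of 0))⁻¹ * (x : PiTpχ p).left * gfpOf (FreeGroup.of 0), (x : PiTpχ p).right⟩ := by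
    rw [MulAut.conjNormal_apply, inv_inv]
    exact genA_inv_mul_mul_genA p x
  have haug : (kummerCoreχ p).augTheta ((ThetaSetting.modelχ p).toTheta
      (SemidirectProduct.inl (gfpOf (FreeGroup.of 0)) : PiTpχ p)) = 1 := rfl
  rw [ContH1.conjCocycle_apply, (kummerCoreχ p).conjNormal_eq_self_of_augTheta_eq_one haug]
  change thetaCocycleFunχ p ⟨_, _⟩ = thetaCocycleFunχ p ⟨(x : PiTpχ p), hxY⟩ * (L ^ (-2 : ℤ)).1 x
  apply Subtype.ext
  have hLx : ((((L ^ (-2 : ℤ)).1 x : ↥(ThetaSetting.modelχ p).DeltaTheta)) : CurveTheta.GTheta (curveχ p)) =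
      (cThetaχ p (yCoordχ p (x : PiTpχ p)))⁻¹ := by
    have hmem := yThetaχ_mem_range_sqHom p (x := (ThetaSetting.modelχ p).toTheta (x : PiTpχ p)) ⟨_, x.2, rfl⟩
    change ((((deltaThetaCoordχ p (half ⟨yThetaχ p ((ThetaSetting.modelχ p).toTheta (x : PiTpχ p)), hmem⟩)) ^
        (-2 : ℤ) : ↥(ThetaSetting.modelχ p).DeltaTheta)) : CurveTheta.GTheta (curveχ p)) = _
    rw [SubgroupClass.coe_zpow, coe_deltaThetaCoordχ, ← map_zpow, zpow_neg, map_inv, zpow_two, ← pow_two,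
      half_sq]
    rfl
  rw [Subgroup.coe_mul, hLx, coe_thetaCocycleFunχ, coe_thetaCocycleFunχ, hconj]
  exact toTheta_inl_centreRep_conj_genA p (left_mem_ker_of_mem_GtpY hxY)


/-- **Deck translates**: `σ₀^k·η̈^Θ = η̈^Θ·log(Ü)^{−2k}` for every `k ∈ ℤ` (stage 1). [cite: MochizukiEtTh2009, Prop 1.5 (iii) p.23] -/
theorem conj_genA_zpow_etaDdχ (hC : (ThetaSetting.modelχ p).Compat) (k : ℤ) :
    haveI := hC.GtpYdd_normal
    ContH1.conj (ThetaSetting.modelχ p).toTheta (ThetaSetting.modelχ p).DeltaTheta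
        ((SemidirectProduct.inl (gfpOf (FreeGroup.of 0)) : PiTpχ p) ^ k) (etaDdχ p) =
      etaDdχ p * ((ThetaSetting.modelχ p).inflTheta (ThetaSetting.modelχ p).GtpYdd (logUddχ p)) ^ (-2 * k) := by
  haveI := hC.GtpYdd_normal
  have hLk : ∀ n : ℤ, ContH1.conj (ThetaSetting.modelχ p).toTheta (ThetaSetting.modelχ p).DeltaTheta
      ((SemidirectProduct.inl (gfpOf (FreeGroup.of 0)) : PiTpχ p) ^ n)
      ((ThetaSetting.modelχ p).inflTheta (ThetaSetting.modelχ p).GtpYdd (logUddχ p)) =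
      (ThetaSetting.modelχ p).inflTheta (ThetaSetting.modelχ p).GtpYdd (logUddχ p) := fun n =>
    conj_zpow_eq_self_of_conj_eq_self p hC (conj_genA_inflTheta_logUdd p hC) n
  induction k using Int.induction_on with
  | zero => rw [zpow_zero, ContH1.conj_one_apply, mul_zero, zpow_zero, mul_one]
  | succ n ih =>
    rw [zpow_add_one, ContH1.conj_mul_apply, conj_genA_etaDdχ p hC, map_mul, map_zpow, ih, hLk, mul_assoc,
      ← zpow_add]
    congr 2
    ring
  | pred n ih =>
    have hL' := hLk (-1)
    rw [zpow_neg_one] at hL'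
    have hinv : ContH1.conj (ThetaSetting.modelχ p).toTheta (ThetaSetting.modelχ p).DeltaTheta
        (SemidirectProduct.inl (gfpOf (FreeGroup.of 0)) : PiTpχ p)⁻¹ (etaDdχ p) =
        etaDdχ p * ((ThetaSetting.modelχ p).inflTheta (ThetaSetting.modelχ p).GtpYdd (logUddχ p)) ^ (2 : ℤ) := by
      have h := congrArg (ContH1.conj (ThetaSetting.modelχ p).toTheta (ThetaSetting.modelχ p).DeltaTheta
        (SemidirectProduct.inl (gfpOf (FreeGroup.of 0)) : PiTpχ p)⁻¹) (conj_genA_etaDdχ p hC)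
      rw [ContH1.conj_inv_conj_apply, map_mul, map_zpow, hL'] at h
      conv_rhs => rw [h]
      rw [mul_assoc, ← zpow_add]
      norm_num
    rw [zpow_sub_one, ContH1.conj_mul_apply, hinv, map_mul, map_zpow, ih, hLk, mul_assoc, ← zpow_add]
    congr 2
    ring

/-! ## §3. The orbit `η̈^{Θ,Z}` at `MuTwoSetting.inversionModelχ′` (`ε_Z := a`) and its values at ANCHORED points -/

/-- **`inclX σ ∈ Π^tp_Ẋ` (`ε_Z := epsZInvχ = inclX a`) forces `σ = y·a^k`, `y ∈ Π^tp_Ÿ`** (abc-iut-f-113's lemma re-read at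
`Π^tp_C = Π^tp_X ⋊_ι ℤ/2`). [cite: MochizukiEtTh2009, Def 1.9 p.29] -/
theorem exists_eq_mul_zpow_of_inclX_mem_dotX_inversionModelχ' {σ : PiTpχ p}
    (hσ : (MuTwoSetting.inversionModelχ' p).inclX σ ∈ (MuTwoSetting.inversionModelχ' p).dotX (epsZInvχ p)) :
    ∃ y ∈ (ThetaSetting.modelχ p).GtpYdd, ∃ k : ℤ,
      σ = y * (SemidirectProduct.inl (gfpOf (FreeGroup.of 0)) : PiTpχ p) ^ k := by
  set a₀ : PiTpχ p := SemidirectProduct.inl (gfpOf (FreeGroup.of 0)) with ha₀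
  haveI : ((Xddχ p).map (inclInvχ p)).Normal := (MuTwoSetting.inversionModelχ' p).map_GtpXdd_normal
  have hmem : inclInvχ p σ ∈ (((Xddχ p).map (inclInvχ p) ⊔ Subgroup.zpowers (epsZInvχ p) :
      Subgroup (PiCInvχ p)) : Set (PiCInvχ p)) := hσ
  rw [Subgroup.normal_mul] at hmem
  obtain ⟨n, hn, h, hh, hnh⟩ := Set.mem_mul.1 hmem
  obtain ⟨x, hx, rfl⟩ := Subgroup.mem_map.1 hn
  obtain ⟨k, rfl⟩ := Subgroup.mem_zpowers_iff.1 hh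
  have hσ' : σ = x * a₀ ^ k := by
    apply (MuTwoSetting.inversionModelχ' p).injective_inclX
    change inclInvχ p σ = inclInvχ p (x * a₀ ^ k)
    rw [map_mul, map_zpow, hnh.symm]
    rfl
  obtain ⟨y, hy, e, rfl⟩ := exists_eq_mul_zpow_of_mem_Xddχ p hx
  refine ⟨y, hy, 2 * e + k, ?_⟩
  rw [hσ', zpow_add, zpow_mul, mul_assoc]
  congr 2
  rw [zpow_ofNat, pow_two]

/-- **Every member of `η̈^{Θ,Z}` at `inversionModelχ′` (`ε_Z := a`) is `η̈^Θ·log(Ü)^{−2k}`** (classes read over the étale-theta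
datum of record `(kummerDataχ′Sec p).etaleThetaDataOfClass (etaDdχ p)`). [cite: MochizukiEtTh2009, Def 1.9 p.29] -/
theorem exists_eq_etaDdχ_mul_zpow_of_mem_thetaOrbit (hC : (MuTwoSetting.inversionModelχ' p).toThetaSetting.Compat)
    {y : (ThetaSetting.modelχ' p).H1 (ThetaSetting.modelχ' p).GtpYdd}
    (hy : y ∈ (MuTwoSetting.inversionModelχ' p).thetaOrbit hC (epsZInvχ p) (etaDdχ p)) :
    ∃ k : ℤ, y = ((kummerDataχ'Sec p).etaleThetaDataOfClass (etaDdχ p)).etaDd *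
      ((ThetaSetting.modelχ' p).inflTheta (ThetaSetting.modelχ' p).GtpYdd (logUddχ p)) ^ (-2 * k) := by
  haveI := (ThetaSetting.modelχ p).compat.GtpYdd_normal
  obtain ⟨σ, hσ, rfl⟩ := hy
  obtain ⟨y', hy', k, rfl⟩ := exists_eq_mul_zpow_of_inclX_mem_dotX_inversionModelχ' p hσ
  refine ⟨k, ?_⟩
  have key : ContH1.conj (ThetaSetting.modelχ p).toTheta (ThetaSetting.modelχ p).DeltaTheta
      (y' * (SemidirectProduct.inl (gfpOf (FreeGroup.of 0)) : PiTpχ p) ^ k) (etaDdχ p) =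
      etaDdχ p * ((ThetaSetting.modelχ p).inflTheta (ThetaSetting.modelχ p).GtpYdd (logUddχ p)) ^ (-2 * k) := by
    rw [ContH1.conj_mul_apply, conj_genA_zpow_etaDdχ p (ThetaSetting.modelχ p).compat k,
      ContH1.conj_eq_self_of_mem y' hy']
  exact key

/-- **`η̈^Θ|_D = 1` on every `b`-axis section `D ≤ s_w(G_K̈)`** (class form of Part I's `thetaCocycleFunχ_sectionOfUnitχ`).
[cite: MochizukiEtTh2009, Prop 1.4 (iii) p.22] -/
theorem res_etaDdχ_eq_one_of_le_map_sectionOfUnitχ (w : (↥(ThetaSetting.modelχ p).Kdd)ˣ) {D : Subgroup (PiTpχ p)}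
    (hD : D ≤ (ThetaSetting.modelχ p).GKdd.map (sectionOfUnitχ p w))
    (hle : D ≤ (ThetaSetting.modelχ' p).GtpYdd) :
    ContH1.res (ThetaSetting.modelχ' p).toTheta (ThetaSetting.modelχ' p).DeltaTheta hle ((kummerDataχ'Sec p).etaleThetaDataOfClass (etaDdχ p)).etaDd = 1 := by
  have hcoc : ContH1.resCocycle (ThetaSetting.modelχ p).toTheta (ThetaSetting.modelχ p).DeltaTheta hle
      (ContH1.resCocycle (ThetaSetting.modelχ p).toTheta (ThetaSetting.modelχ p).DeltaTheta
        (ThetaSetting.modelχ p).GtpYdd_le_GtpY (thetaCocycleχ p)) = 1 := by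
    apply Subtype.ext
    funext x
    obtain ⟨σ, -, hσ⟩ := Subgroup.mem_map.1 (hD x.2)
    exact thetaCocycleFunχ_eq_one_of_left_eq_bPowGfp p _ (kappaUnitχ p w σ * kappaUnitχ p w σ)
      (by change (x : PiTpχ p).left = _; rw [← hσ]; rfl)
  change (QuotientGroup.mk (ContH1.resCocycle (ThetaSetting.modelχ p).toTheta (ThetaSetting.modelχ p).DeltaTheta hle
    (ContH1.resCocycle (ThetaSetting.modelχ p).toTheta (ThetaSetting.modelχ p).DeltaTheta
      (ThetaSetting.modelχ p).GtpYdd_le_GtpY (thetaCocycleχ p))) : ContH1 _ _ _) = 1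
  rw [hcoc]
  rfl

/-- **Values of `η̈^{Θ,Z}` at an ANCHORED point of `χ′`** (`D_y = s_w(G_K̈)`, `Ü(y) = w`): every value is `w^{−2k}`
(`η̈^Θ|_{D_y} = 1`, `log(Ü)|_y = w`). [cite: MochizukiEtTh2009, Def 1.9 (i) p.29] -/
theorem exists_toKddHat_eq_of_mem_valuesAt_etaDdχ_anchoredPointχ'OfUnit
    (hC : (MuTwoSetting.inversionModelχ' p).toThetaSetting.Compat) (w : (↥(ThetaSetting.modelχ p).Kdd)ˣ)
    (hw : ∀ a : ℤ, ((w : (ThetaSetting.modelχ p).Kdd) : PadicAlgCl p) ≠ (ThetaSetting.modelχ p).qdd ^ a ∧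
      ((w : (ThetaSetting.modelχ p).Kdd) : PadicAlgCl p) ≠ -((ThetaSetting.modelχ p).qdd ^ a))
    {v : (↥(ThetaSetting.modelχ' p).Kdd)ˣ}
    (hv : v ∈ MuTwoSetting.valuesAt (M := MuTwoSetting.inversionModelχ' p) hC (epsZInvχ p) (etaDdχ p)
      (anchoredPointχ'OfUnit p w hw).toNonCuspidalPoint) :
    ∃ k : ℤ, (kummerDataχ'Sec p).toKddHat v = (kummerDataχ'Sec p).toKddHat (w ^ (-2 * k)) := by
  obtain ⟨y, hy, hyv⟩ := hv
  obtain ⟨k, rfl⟩ := exists_eq_etaDdχ_mul_zpow_of_mem_thetaOrbit p hC hy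
  refine ⟨k, ?_⟩
  have hL : (anchoredPointχ'OfUnit p w hw).evalAt (ContH1.res (ThetaSetting.modelχ' p).toTheta
      (ThetaSetting.modelχ' p).DeltaTheta (anchoredPointχ'OfUnit p w hw).Dpt_le
      ((ThetaSetting.modelχ' p).inflTheta (ThetaSetting.modelχ' p).GtpYdd (logUddχ p))) =
      (kummerDataχ'Sec p).toKddHat w :=
    (anchoredPointχ'OfUnit p w hw).evalAt_logUdd
  rw [← hyv, map_mul, map_mul, map_zpow, map_zpow, hL,
    res_etaDdχ_eq_one_of_le_map_sectionOfUnitχ p w (le_of_eq (Dpt_anchoredPointχ'OfUnit p w hw)), map_one, one_mul]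
  exact (map_zpow _ _ _).symm

/-- `(√−1)² = −1` in `K̈^×`, hence `((√−1)^{±1})^{−2k} = ±1` as units. [cite: MochizukiEtTh2009, Def 1.9 p.29] -/
theorem sqrtNegOneUnitχ_zpow_neg_two_mul (hp : p % 4 = 1) (k : ℤ) :
    ((sqrtNegOneUnitχ p hp) ^ (-2 * k) = 1 ∨ (sqrtNegOneUnitχ p hp) ^ (-2 * k) = -1) ∧
    ((sqrtNegOneInvUnitχ p hp) ^ (-2 * k) = 1 ∨ (sqrtNegOneInvUnitχ p hp) ^ (-2 * k) = -1) := by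
  have hsq : (sqrtNegOneUnitχ p hp) ^ (2 : ℤ) = -1 := by
    apply Units.ext
    apply Subtype.ext
    rw [zpow_two, Units.val_mul, Units.val_neg, Units.val_one]
    push_cast
    rw [coe_sqrtNegOneUnitχ, ← pow_two, sqrtNegOneχ_sq]
  have hsq' : (sqrtNegOneInvUnitχ p hp) ^ (2 : ℤ) = -1 := by
    rw [sqrtNegOneInvUnitχ_eq_inv, inv_zpow, hsq, inv_neg, inv_one]
  have key : ∀ x : (↥(ThetaSetting.modelχ p).Kdd)ˣ, x ^ (2 : ℤ) = -1 → x ^ (-2 * k) = 1 ∨ x ^ (-2 * k) = -1 := by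
    intro x hx
    rw [show -2 * k = 2 * (-k) by ring, zpow_mul, hx]
    rcases Int.even_or_odd (-k) with h | h
    · exact Or.inl h.neg_one_zpow
    · exact Or.inr h.neg_one_zpow
  exact ⟨key _ hsq, key _ hsq'⟩

/-! ## §4. F-0573 `IsOfStandardType` and F-0513 `Thm110iUnique` for THE class of record at THE anchored Def 1.9 pair of `χ′` -/

/-- **F-0573 / Def 1.9 (ii) HOLDS for `η̈^Θ = etaDdχ` at the ANCHORED Def 1.9 datum of `inversionModelχ′`** (`τ := tauχ′`,
`D_τ = s_{√−1}(G_K̈)`, `Ü(τ) = √−1`, `p ≡ 1 (mod 4)`): the standard set of values at `τ` lies in `{±1}` and contains `1`.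
[cite: MochizukiEtTh2009, Def 1.9 (ii) p.29] -/
theorem isOfStandardType_etaDdχ_anchoredStandardDataχ'Sec (hp : p % 4 = 1) :
    MuTwoSetting.IsOfStandardType (M := MuTwoSetting.inversionModelχ' p) (MuTwoSetting.inversionModelχ'_compat p)
      (epsZInvχ p) (anchoredStandardDataχ'Sec p hp).toStandardData (etaDdχ p) := by
  have h1 : (1 : (↥(ThetaSetting.modelχ' p).Kdd)ˣ) ∈ MuTwoSetting.valuesAt (M := MuTwoSetting.inversionModelχ' p)
      (MuTwoSetting.inversionModelχ'_compat p) (epsZInvχ p) (etaDdχ p) (tauχ' p hp).toNonCuspidalPoint := by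
    refine ⟨etaDdχ p, MuTwoSetting.mem_thetaOrbit_self _ _ _, ?_⟩
    rw [map_one]
    exact res_etaDdχ_eq_one_of_le_map_sectionOfUnitχ p (sqrtNegOneUnitχ p hp) (le_of_eq (Dpt_tauχ' p hp)) _ ▸ map_one _
  refine ⟨_, Or.inl rfl, 1, h1, fun w hw => ?_, one_mem _, Or.inl (by simp)⟩
  obtain ⟨k, hk⟩ := exists_toKddHat_eq_of_mem_valuesAt_etaDdχ_anchoredPointχ'OfUnit p _ (sqrtNegOneUnitχ p hp)
    (sqrtNegOneUnitχ_ne_cusp p hp) hw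
  rcases (sqrtNegOneUnitχ_zpow_neg_two_mul p hp k).1 with h | h <;> rw [h] at hk <;>
    rw [(kummerDataχ'Sec p).toKddHat_injective hk] <;> simp

/-- **F-0513 `Thm110iUnique` HOLDS for `etaDdχ` at the ANCHORED Def 1.9 datum of `inversionModelχ′`** (`p ≡ 1 (mod 4)`, `ε_Z := a`):
every value of `(u·η̈)^{Θ,Z}` at `τ^{±1}` is `±u` (every `σ ∈ Π^tp_X` fixes the Kummer class of `u`, abc-iut-f-113), so standard
type of both orbits pins `u = ±1`. [cite: MochizukiEtTh2009, Thm 1.10 (i) p.29] -/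
theorem thm110iUnique_etaDdχ_anchoredStandardDataχ'Sec (hp : p % 4 = 1) :
    Thm110iUnique (M := MuTwoSetting.inversionModelχ' p) (MuTwoSetting.inversionModelχ'_compat p)
      (MuTwoSetting.inversionModelχ'_isAdmissibleEpsZ p) ((kummerDataχ'Sec p).etaleThetaDataOfClass (etaDdχ p))
      (anchoredStandardDataχ'Sec p hp).toStandardData := by
  intro u _ _ h2
  haveI := (ThetaSetting.modelχ p).compat.GtpYdd_normal
  obtain ⟨V, hV, v, hv, -, -, hpm⟩ := h2
  have horb : ∀ y ∈ MuTwoSetting.thetaOrbit (M := MuTwoSetting.inversionModelχ' p) (MuTwoSetting.inversionModelχ'_compat p)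
      (epsZInvχ p) ((ThetaSetting.modelχ' p).inflTheta (ThetaSetting.modelχ' p).GtpYdd
        ((kummerDataχ'Sec p).kumYdd ((kummerDataχ'Sec p).toKddHat u)) * ((kummerDataχ'Sec p).etaleThetaDataOfClass (etaDdχ p)).etaDd),
      ∃ k : ℤ, y = (ThetaSetting.modelχ' p).inflTheta (ThetaSetting.modelχ' p).GtpYdd
        ((kummerDataχ'Sec p).kumYdd ((kummerDataχ'Sec p).toKddHat u)) * (((kummerDataχ'Sec p).etaleThetaDataOfClass (etaDdχ p)).etaDd *
          ((ThetaSetting.modelχ' p).inflTheta (ThetaSetting.modelχ' p).GtpYdd (logUddχ p)) ^ (-2 * k)) := by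
    rintro y ⟨σ, hσ, rfl⟩
    obtain ⟨y', hy', k, rfl⟩ := exists_eq_mul_zpow_of_inclX_mem_dotX_inversionModelχ' p hσ
    refine ⟨k, ?_⟩
    have hK : ContH1.conj (ThetaSetting.modelχ p).toTheta (ThetaSetting.modelχ p).DeltaTheta
        (y' * (SemidirectProduct.inl (gfpOf (FreeGroup.of 0)) : PiTpχ p) ^ k)
        ((ThetaSetting.modelχ p).inflTheta (ThetaSetting.modelχ p).GtpYdd
          ((kummerDataχSec p).kumYdd ((kummerDataχSec p).toKddHat u))) =
        (ThetaSetting.modelχ p).inflTheta (ThetaSetting.modelχ p).GtpYdd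
          ((kummerDataχSec p).kumYdd ((kummerDataχSec p).toKddHat u)) :=
      conj_inflTheta_kumYdd_modelχ p (ThetaSetting.modelχ p).compat _ u
    have key : ContH1.conj (ThetaSetting.modelχ p).toTheta (ThetaSetting.modelχ p).DeltaTheta
        (y' * (SemidirectProduct.inl (gfpOf (FreeGroup.of 0)) : PiTpχ p) ^ k)
        ((ThetaSetting.modelχ p).inflTheta (ThetaSetting.modelχ p).GtpYdd
          ((kummerDataχSec p).kumYdd ((kummerDataχSec p).toKddHat u)) * etaDdχ p) =
        (ThetaSetting.modelχ p).inflTheta (ThetaSetting.modelχ p).GtpYdd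
          ((kummerDataχSec p).kumYdd ((kummerDataχSec p).toKddHat u)) * (etaDdχ p *
            ((ThetaSetting.modelχ p).inflTheta (ThetaSetting.modelχ p).GtpYdd (logUddχ p)) ^ (-2 * k)) := by
      rw [map_mul, hK, ContH1.conj_mul_apply, conj_genA_zpow_etaDdχ p (ThetaSetting.modelχ p).compat k,
        ContH1.conj_eq_self_of_mem y' hy']
    exact key
  have hval : ∀ (w : (↥(ThetaSetting.modelχ p).Kdd)ˣ) (hw), v ∈ MuTwoSetting.valuesAt (M := MuTwoSetting.inversionModelχ' p)
        (MuTwoSetting.inversionModelχ'_compat p) (epsZInvχ p)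
        ((ThetaSetting.modelχ' p).inflTheta (ThetaSetting.modelχ' p).GtpYdd
          ((kummerDataχ'Sec p).kumYdd ((kummerDataχ'Sec p).toKddHat u)) * ((kummerDataχ'Sec p).etaleThetaDataOfClass (etaDdχ p)).etaDd)
        (anchoredPointχ'OfUnit p w hw).toNonCuspidalPoint →
        ∃ k : ℤ, (kummerDataχ'Sec p).toKddHat v =
          (kummerDataχ'Sec p).toKddHat u * (kummerDataχ'Sec p).toKddHat (w ^ (-2 * k)) := by
    rintro w hw ⟨y, hy, hyv⟩
    obtain ⟨k, rfl⟩ := horb y hy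
    refine ⟨k, ?_⟩
    have hL : (anchoredPointχ'OfUnit p w hw).evalAt (ContH1.res (ThetaSetting.modelχ' p).toTheta
        (ThetaSetting.modelχ' p).DeltaTheta (anchoredPointχ'OfUnit p w hw).Dpt_le
        ((ThetaSetting.modelχ' p).inflTheta (ThetaSetting.modelχ' p).GtpYdd (logUddχ p))) =
        (kummerDataχ'Sec p).toKddHat w :=
      (anchoredPointχ'OfUnit p w hw).evalAt_logUdd
    have hKev := (anchoredPointχ'OfUnit p w hw).evalAt_kum ((kummerDataχ'Sec p).toKddHat u)
    rw [← hyv, map_mul, map_mul, map_mul, map_mul, map_zpow, map_zpow, hL, hKev,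
      res_etaDdχ_eq_one_of_le_map_sectionOfUnitχ p w (le_of_eq (Dpt_anchoredPointχ'OfUnit p w hw)), map_one, one_mul]
    congr 1
    exact (map_zpow _ _ _).symm
  have hfin : ∀ w : (↥(ThetaSetting.modelχ p).Kdd)ˣ, (w = 1 ∨ w = -1) →
      (kummerDataχ'Sec p).toKddHat v = (kummerDataχ'Sec p).toKddHat u * (kummerDataχ'Sec p).toKddHat w →
      ((u : (ThetaSetting.modelχ' p).Kdd) : PadicAlgCl p) = 1 ∨ ((u : (ThetaSetting.modelχ' p).Kdd) : PadicAlgCl p) = -1 := by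
    rintro w (rfl | rfl) h
    · rw [← map_mul] at h
      have hv' := (kummerDataχ'Sec p).toKddHat_injective h
      rw [hv'] at hpm
      simpa using hpm
    · rw [← map_mul] at h
      have hv' := (kummerDataχ'Sec p).toKddHat_injective h
      rw [hv'] at hpm
      have hpm' : -(((u : (ThetaSetting.modelχ' p).Kdd) : PadicAlgCl p)) = 1 ∨
          -(((u : (ThetaSetting.modelχ' p).Kdd) : PadicAlgCl p)) = -1 := by simpa using hpm
      rcases hpm' with h | h
      · right; linear_combination -h
      · left; linear_combination -h
  rcases hV with rfl | rfl
  · obtain ⟨k, hk⟩ := hval (sqrtNegOneUnitχ p hp) (sqrtNegOneUnitχ_ne_cusp p hp) hv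
    rcases (sqrtNegOneUnitχ_zpow_neg_two_mul p hp k).1 with h | h <;> rw [h] at hk
    · exact hfin 1 (Or.inl rfl) hk
    · exact hfin (-1) (Or.inr rfl) hk
  · obtain ⟨k, hk⟩ := hval (sqrtNegOneInvUnitχ p hp) (sqrtNegOneInvUnitχ_ne_cusp p hp) hv
    rcases (sqrtNegOneUnitχ_zpow_neg_two_mul p hp k).2 with h | h <;> rw [h] at hk
    · exact hfin 1 (Or.inl rfl) hk
    · exact hfin (-1) (Or.inr rfl) hk

end Literature.AnabelianGeometry.EtaleTheta.SettingModel

end
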